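import Summits.BirchSwinnertonDyer.Rank1Residual.X10.ResidualSelmerGeneratorTestRecord118810j1
import Summits.BirchSwinnertonDyer.Rank1Residual.X10.ResidualSelmerCompanions
import Summits.BirchSwinnertonDyer.Rank1Residual.X10.SelmerCompanionsTamagawaFree
import Summits.BirchSwinnertonDyer.Rank1Residual.GaloisImage.ThreeCongruenceHesseCertificateLemmas
import Literature.NumberTheory.EllipticCurves.Fisher2012.HesseFamilyThreeReverseProofs
import HarnessLib

/-!
# N2 (X10b @ 3): THE GENERATOR TEST (G) TEMPLATE APPLIED — part C: `169280da1`, `372416df1` ← `169280cy1` (ℓ = 5)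
# (cell `b2b-bsdres`, unit `b2b-bsdres-x10` = N2 class lead, GEN 32; RECORDS — theorems only, no
# definition; named-fact hypotheses DISPLAYED: `poitouTate_selmerStructure_duality ℚ` (PT),
# `selmerLocalKer_iff_of_goodReduction_above` (hMR) for the transports; census `#Sel₃(E′) = 3` of the
# rank-1 partner displayed; nothing booked)

HONEST FRAMING (run/shared/lean/b2b/bsd-rank1-residual/, verbatim in every file): the goal of the
cell is to DELETE the COMBINATION-SHAPED residual classes of the Birch–Swinnerton-Dyer formula for
ALL analytic-rank `≤ 1` elliptic curves over `ℚ` — "full BSD formula for every rank `≤ 1` curve in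
class `C`" assembled STRICTLY from published theorems — so that the rank-`≤ 1` remainder becomes
exactly the CONSTRUCTION-SHAPED classes, which are TYPED (missing-input `Prop`s), NOT attempted.
This is not "finishing BSD". Class X10b (= N2) keeps its label CONSTRUCTION-SHAPED (NEEDS `X_A3`,
referee R82.3 / RESIDUAL-MAP §I N2); these are RECORDS (evidence for the TRIVIAL-ROADS memo §9 rows
"S⁰ = 0 by (G) at a partner", now read in the kernel); no mark / label / tier / count of record moves.

## What

The template of `X10/ResidualSelmerGeneratorTestRecord118810j1.lean` (x10 GEN 32): for a rank-`1`
curve `E′` (Cremona: `r = 1`, `E′(ℚ)_tors = 0`, `Ш_an = 1`, so the census reads `#Sel₃(E′) = 3`) whose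
ONLY Tamagawa-`3` place is a SPLIT `I₃` place `ℓ` and whose generator `P` reduces to the node `mod ℓ`:
`localKummerMap_not_mem_unramified_e<E′>` (`κ_ℓ(P) ∉ H¹_ur`, every `E`-side datum by `decide +kernel`:
the Tate row at `ℓ`, `ord_ℓ Δ = 3`, the translate to the node, the `ℓ`-adic size of `x − r`, `y − t`),
`residualSelmerGroup_eq_bot_e<E′>` (`S⁰(E′) = ⊥` modulo PT + the census, by `generatorTest_of_rowCheck`),
and for each N2 cell `E` `3`-congruent to `E′` a KERNEL congruence `torsionIso_e<E>_e<E′>` (Fisher's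
Hesse pencils, certificate `(kind, l, m, u)` by n1011-p07 `certlib` over n1011-r2 `hesse3lib`) with
`residualSelmerGroup_eq_bot_e<E>` (`S⁰(E) = ⊥` modulo PT + hMR + the census of `E′`, by
`ResidualSelmerCompanions.residualSelmerGroup_eq_bot_iff_of_congr`; both curves good at `3`).
Cells of this part: 169280da1, 372416df1 (S⁰ = 0 already by the unit road (X): a SECOND, independent road). Generator `g32/gen/mkgentest32.py`, data `g32/out/gentest32.json`
(Cremona `allgens`/`allbsd`, n1011-p03 `tamcert` rows).

References: [MazurRubin2007] Prop. 1.3 (i), Thm. 1.4; [MazurRubin2015SelmerCompanions] Thm. 3.1 (iv)(b);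
[Fisher2012Hessian] Thm. 13.2, §13; [SilvermanAEC2009] VII.1.3(b), X.§4; [Cremona2006] Table 1;
HOME/class-closure/N2/TRIVIAL-ROADS-x10g27.md §9; HOME/X10-AUDIT.md §38.9.
-/

set_option autoImplicit false

noncomputable section

open scoped Classical NNReal

open Function NumberField IsDedekindDomain Field WeierstrassCurve IsLocalRing
  Literature.NumberTheory.EllipticCurves Literature.NumberTheory.GaloisRepresentations
  Literature.NumberTheory.GaloisCohomology IsDedekindDomain.HeightOneSpectrum Rat.HeightOneSpectrum
  Literature.NumberTheory.EllipticCurves.MazurRubin2015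
  Literature.NumberTheory.EllipticCurves.Fisher2012
  Summit.BirchSwinnertonDyer.BirchSwinnertonDyer.Rank1Residual.IntModel
  Summit.BirchSwinnertonDyer.BirchSwinnertonDyer.Theorems.Rank1ResidualX1Defs
  Summit.BirchSwinnertonDyer.Rank1Residual.X11b
  Summit.BirchSwinnertonDyer.Rank1Residual.GaloisImage
  Summit.BirchSwinnertonDyer.Rank1Residual.X1.CongruenceTransfer
open Literature.NumberTheory.GaloisRepresentations.DiscreteGaloisModule (unramifiedSubgroup)
open Summit.BirchSwinnertonDyer.BirchSwinnertonDyer.Rank2Observatory.Tam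
open Summit.BirchSwinnertonDyer.Rank1Residual.Additive
open Summit.BirchSwinnertonDyer.Rank1Residual.X10.ResidualSelmerGroup
open Summit.BirchSwinnertonDyer.Rank1Residual.X10.ResidualSelmerParityRat
open Summit.BirchSwinnertonDyer.Rank1Residual.X10.ResidualSelmerLocalRamificationInt
open Summit.BirchSwinnertonDyer.Rank1Residual.X10.ResidualSelmerLocalRamificationRat
open Summit.BirchSwinnertonDyer.Rank1Residual.X10.ResidualSelmerCompanions
open Summit.BirchSwinnertonDyer.Rank1Residual.X10.SelmerCompanionsTamagawaFree
open Summit.BirchSwinnertonDyer.Rank1Residual.X10.ResidualSelmerGeneratorTestRecord118810j1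

namespace Summit.BirchSwinnertonDyer.Rank1Residual.X10.ResidualSelmerGeneratorTestRecords

/-! ### Partner `169280cy1 = [0, -1, 0, -32445, 6208775]` — `r = 1`, `E(ℚ)_tors = 0`, `Ш_an = 1`; 2: II (c = 1); 5: In (c = 3); 23: III* (c = 2); `P = (67210/81, 17094635/729)` -/

/-- The rational point `P = (67210/81, 17094635/729)` (Cremona's generator) lies on `169280cy1`.
[cite: Cremona2006, Table 1 (Cremona label 169280cy1)] -/
theorem nonsingular_point_e169280cy1 :
    ((⟨0, -1, 0, -32445, 6208775⟩ : WeierstrassCurve ℤ).baseChange ℚ).toAffine.Nonsingular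
      (67210 / 81 : ℚ) (17094635 / 729 : ℚ) := by
  rw [Affine.nonsingular_iff, Affine.equation_iff]
  simp only [baseChange, map_a₁, map_a₂, map_a₃, map_a₄, map_a₆]
  norm_num

/-- **`κ_5(P)` is RAMIFIED** for `P = (67210/81, 17094635/729) ∈ 169280cy1(ℚ)` at the split `I₃` place `5`
(`P ≡ (0, 0)` = the node `mod 5`; translate `(r, t) = (0, 0)`: `x − r = 67210/81`, `y − t = 17094635/729`);
all `E`-side data in the kernel; no named fact. [cite: SilvermanAEC2009, VII.1 Prop. 1.3(b) and X.§4 diagram (**)]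
[cite: MazurRubin2007, proof of Thm. 1.4] -/
theorem localKummerMap_not_mem_unramified_e169280cy1
    (W : WeierstrassCurve ℚ) [W.IsElliptic] [hGM : W.IsGloballyMinimal]
    (hI : integralModelInt W = ⟨0, -1, 0, -32445, 6208775⟩)
    (hP : W.toAffine.Nonsingular (67210 / 81 : ℚ) (17094635 / 729 : ℚ))
    (v : HeightOneSpectrum (𝓞 ℚ)) (hv : natGenerator v = 5) (hp0 : ((3 : ℕ) : ℤ) ≠ 0) :
    W.localKummerMap (v.adicCompletion ℚ) hp0
        (Affine.Point.baseChange (W' := W) ℚ (v.adicCompletion ℚ) (.some _ _ hP)) ∉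
      unramifiedSubgroup ((W.torsionGaloisModule ((3 : ℕ) : ℤ)).restrictField (v.adicCompletion ℚ)) 1 := by
  have hW : W = (⟨0, -1, 0, -32445, 6208775⟩ : WeierstrassCurve ℤ).baseChange ℚ :=
    IntModelTam.eq_baseChange_of_integralModelInt hI
  subst hW
  have hpv : ((3 : ℕ) : 𝓞 ℚ) ∉ v.asIdeal := fun h => by
    have h' := (natCast_mem_asIdeal_iff_natGenerator_eq Nat.prime_three v).mp h
    rw [hv] at h'
    exact absurd h' (by decide)
  have hcheck : TamLocal.check ⟨5, 2, 1, 3, 0, 0, 0, 3, 0, 0, 3⟩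
      (⟨0, -1, 0, -32445, 6208775⟩ : WeierstrassCurve ℤ) = true := by
    decide +kernel
  have hsplit : ((⟨0, -1, 0, -32445, 6208775⟩ : WeierstrassCurve ℤ).baseChange ℚ).HasSplitMultiplicativeReductionAt v :=
    hasSplitMultiplicativeReductionAt_of_check hcheck rfl v hv
  have hn : ((⟨0, -1, 0, -32445, 6208775⟩ : WeierstrassCurve ℤ).baseChange ℚ).ordMinimalDiscriminant v = 3 :=
    ordMinimalDiscriminant_int_eq hv (hGM.isMinimal v) (by decide +kernel) (by decide +kernel)
  have hX := baseChange_map_int_adicCompletion ⟨0, -1, 0, -32445, 6208775⟩ v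
  rw [localKummerMap_mem_unramifiedSubgroup_iff_hasNonsingularReduction_int _ v hpv hsplit hn hp0 hX]
  have h' : ((((⟨0, -1, 0, -32445, 6208775⟩ : WeierstrassCurve ℤ).map
        (Int.castRingHom (v.adicCompletionIntegers ℚ))).baseChange (v.adicCompletion ℚ))).toAffine.Nonsingular
      (algebraMap ℚ (v.adicCompletion ℚ) (67210 / 81 : ℚ)) (algebraMap ℚ (v.adicCompletion ℚ) (17094635 / 729 : ℚ)) := by
    rw [hX]
    exact (Affine.map_nonsingular (W := ((⟨0, -1, 0, -32445, 6208775⟩ : WeierstrassCurve ℤ).baseChange ℚ))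
      (algebraMap ℚ (v.adicCompletion ℚ)).injective _ _).mpr hP
  have hbc : Affine.Point.congrEquiv hX.symm (Affine.Point.baseChange
      (W' := ((⟨0, -1, 0, -32445, 6208775⟩ : WeierstrassCurve ℤ).baseChange ℚ)) ℚ (v.adicCompletion ℚ)
        (.some _ _ hP)) = .some _ _ h' := by
    rw [Affine.Point.baseChange, Affine.Point.map_some, Affine.Point.congrEquiv_some]
    exact point_some_congr (Algebra.ofId_apply _ _) (Algebra.ofId_apply _ _)
  rw [hbc]
  exact not_hasNonsingularReduction_of_reduces_to_node v ⟨0, -1, 0, -32445, 6208775⟩ 0 0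
    (by rw [hv]; decide +kernel) (by rw [hv]; decide +kernel) (m := 67210) (n := 81) (m' := 17094635) (n' := 729)
    (by rw [hv]; decide +kernel) (by rw [hv]; decide +kernel) (by rw [hv]; decide +kernel)
    (by rw [hv]; decide +kernel) (by norm_num) (by norm_num) h'

/-- **`S⁰(169280cy1) = ⊥` — the generator test (G) DECIDED IN THE KERNEL** for the rank-`1` partner
`169280cy1`: the Kummer class of its generator is a non-zero Selmer class RAMIFIED at `5`, so the first
alternative of `generatorTest_of_rowCheck` (ℓ₀ = 5) applies. CONDITIONAL on the Poitou–Tate fact and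
the census `hs : #Sel₃ = 3` (`r = 1`, trivial torsion, `Ш_an = 1`); nothing else; nothing booked.
[cite: MazurRubin2007, Prop. 1.3 (i) and Thm. 1.4] [cite: Cremona2006, Table 1 (Cremona label 169280cy1)] -/
theorem residualSelmerGroup_eq_bot_e169280cy1 (hfact : poitouTate_selmerStructure_duality ℚ)
    (W : WeierstrassCurve ℚ) [W.IsElliptic] [W.IsGloballyMinimal]
    (hI : integralModelInt W = ⟨0, -1, 0, -32445, 6208775⟩)
    (hs : Nat.card (W.selmerGroup (3 : ℤ)) = 3) : residualSelmerGroup W 3 = ⊥ := by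
  have hP : W.toAffine.Nonsingular (67210 / 81 : ℚ) (17094635 / 729 : ℚ) := by
    rw [IntModelTam.eq_baseChange_of_integralModelInt hI]; exact nonsingular_point_e169280cy1
  have hp0 : ((3 : ℕ) : ℤ) ≠ 0 := by norm_num
  have hdiv : ∀ P : geomPoints W, ∃ Q : geomPoints W, ((3 : ℕ) : ℤ) • Q = P :=
    W.zsmul_geomPoints_surjective_holds (by norm_num)
  have hloc := localKummerMap_not_mem_unramified_e169280cy1 W hI hP (pl 5)
    (natGenerator_pl (by norm_num)) hp0
  have key := KummerIndex.res_kummerMapTorsion_eq_localKummerMap W ((pl 5).adicCompletion ℚ) hp0 hdiv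
    (.some _ _ hP)
  have hloc' : galoisCohomology.res (W.torsionGaloisModule ((3 : ℕ) : ℤ)) ((pl 5).adicCompletion ℚ) 1
        (kummerMapTorsion W ((3 : ℕ) : ℤ) hdiv (.some _ _ hP)) ∉
      unramifiedSubgroup ((W.torsionGaloisModule ((3 : ℕ) : ℤ)).restrictField
        ((pl 5).adicCompletion ℚ)) 1 := by
    intro h
    rw [key] at h
    exact hloc h
  have hram : galoisCohomology.localization (W.torsionGaloisModule ((3 : ℕ) : ℤ)) (Sum.inr (pl 5)) 1
        (kummerMapTorsion W ((3 : ℕ) : ℤ) hdiv (.some _ _ hP)) ∉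
      unramifiedSubgroup (GaloisRep.toLocal (pl 5) (W.torsionGaloisModule ((3 : ℕ) : ℤ))) 1 :=
    fun h => hloc' ((localization_inr_mem_unramifiedSubgroup_iff W ((3 : ℕ) : ℤ) (pl 5) _).mp h)
  have hc : kummerMapTorsion W ((3 : ℕ) : ℤ) hdiv (.some _ _ hP) ∈ W.selmerGroup ((3 : ℕ) : ℤ) :=
    kummerMapTorsion_mem_selmerGroup W _ hdiv _
  have hc0 : kummerMapTorsion W ((3 : ℕ) : ℤ) hdiv (.some _ _ hP) ≠ 0 := fun h0 => hloc' (by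
    have hz : galoisCohomology.res (W.torsionGaloisModule ((3 : ℕ) : ℤ)) ((pl 5).adicCompletion ℚ) 1
        (kummerMapTorsion W ((3 : ℕ) : ℤ) hdiv (.some _ _ hP)) = 0 := by
      rw [h0]; exact (galoisCohomology.res _ _ 1).map_zero
    rw [hz]; exact zero_mem _)
  exact (generatorTest_of_rowCheck 3 (by decide) hfact W hI
    (Es := [⟨2, 1, 4, 0, 1, 0, 0, 6, 2, 1, 1⟩, ⟨5, 2, 1, 3, 0, 0, 0, 3, 0, 0, 3⟩, ⟨23, 4, 5, 0, 353, 0, 0, 9, 9, 0, 2⟩])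
    (by decide +kernel) (ℓ₀ := 5) (by decide +kernel) (by decide +kernel) hs hc hc0).1 hram


/-! ### Cell `169280da1 = [0, -1, 0, -61, -489]` (UNIT road (S⁰ = 0 by (X) already)) ← partner `169280cy1`: DUAL Hesse certificate `(l : m) = (-8464 : 1)`, `u = 1/92` -/

/-- **`169280da1[3] ≃ 169280cy1[3]` as `Γ_ℚ`-modules, IN THE KERNEL** (no named fact): `169280da1` is `ℚ`-isomorphic to the
member `(l : m) = (-8464 : 1)`, `u = 1/92`, of the DUAL Hesse pencil `X_E⁻(3)` (Fisher 2012 §13; tree THEOREM `thm132rev_threeCongruent_dualHessePencil_holds`) of `169280cy1`; the two covariant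
identities are numeral identities (`norm_num`). [cite: Fisher2012Hessian, §13 (analogue of Thm. 13.2 for X_E^-(3)) and §8]
[cite: Cremona2006, Table 1 (Cremona labels 169280da1, 169280cy1)] -/
theorem torsionIso_e169280da1_e169280cy1 (W A : WeierstrassCurve ℚ) [W.IsElliptic] [A.IsElliptic]
    (hW : W = ⟨0, -1, 0, -32445, 6208775⟩) (hA : A = ⟨0, -1, 0, -61, -489⟩) :
    TorsionIso A W 3 :=
  VisCerts.torsionIso3_of_dualHesseCert_mk thm132rev_threeCongruent_dualHessePencil_holds
    hW hA
    (1557376 : ℚ) (-5355037376 : ℚ) (2944 : ℚ) (440128 : ℚ)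
    (by norm_num) (by norm_num) (by norm_num) (by norm_num)
    (-8464 : ℚ) (1 : ℚ) ((1 : ℚ) / 92) (by norm_num) (by norm_num) (by norm_num)

/-- **`S⁰(169280da1) = ⊥` IN THE KERNEL** (modulo the displayed PT fact, hMR, and the partner's census
`#Sel₃(169280cy1) = 3`): the partner's generator test `residualSelmerGroup_eq_bot_e169280cy1` transported along
`torsionIso_e169280da1_e169280cy1` by `residualSelmerGroup_eq_bot_iff_of_congr` (both curves good at `3`, `decide`
on `Δ`). Per cell; EVIDENCE for TRIVIAL-ROADS §9; nothing booked, no count moved here.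
[cite: MazurRubin2007, Prop. 1.3 (i) and Thm. 1.4] [cite: MazurRubin2015SelmerCompanions, Thm. 3.1 (iv)(b)]
[cite: Cremona2006, Table 1 (Cremona labels 169280da1, 169280cy1)] -/
theorem residualSelmerGroup_eq_bot_e169280da1 (hfact : poitouTate_selmerStructure_duality ℚ)
    (hMR : selmerLocalKer_iff_of_goodReduction_above)
    (W A : WeierstrassCurve ℚ) [W.IsElliptic] [W.IsGloballyMinimal] [A.IsElliptic] [A.IsGloballyMinimal]
    (hIW : integralModelInt W = ⟨0, -1, 0, -61, -489⟩)
    (hIA : integralModelInt A = ⟨0, -1, 0, -32445, 6208775⟩)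
    (hsA : Nat.card (A.selmerGroup (3 : ℤ)) = 3) : residualSelmerGroup W 3 = ⊥ := by
  have hW : W = ⟨0, -1, 0, -61, -489⟩ := by
    rw [IntModelTam.eq_baseChange_of_integralModelInt hIW]; ext <;> simp [baseChange, WeierstrassCurve.map]
  have hA : A = ⟨0, -1, 0, -32445, 6208775⟩ := by
    rw [IntModelTam.eq_baseChange_of_integralModelInt hIA]; ext <;> simp [baseChange, WeierstrassCurve.map]
  obtain ⟨θ, hθ⟩ := torsionIso_e169280da1_e169280cy1 A W hA hW
  have hgood : ∀ v : HeightOneSpectrum (𝓞 ℚ), ((3 : ℕ) : 𝓞 ℚ) ∈ v.asIdeal →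
      A.HasGoodReductionAt v ∧ W.HasGoodReductionAt v := fun v hv =>
    ⟨hasGoodReductionAt_of_map_eq_of_not_dvd (p := 3) A (hIA ▸ map_integralModelInt A)
        (by decide +kernel) v hv,
      hasGoodReductionAt_of_map_eq_of_not_dvd (p := 3) W (hIW ▸ map_integralModelInt W)
        (by decide +kernel) v hv⟩
  exact (residualSelmerGroup_eq_bot_iff_of_congr A W 3 hMR (by decide) θ hθ hgood).mpr
    (residualSelmerGroup_eq_bot_e169280cy1 hfact A hIA hsA)


/-! ### Cell `372416df1 = [0, -1, 0, -33089, 590657]` (UNIT road (S⁰ = 0 by (X) already)) ← partner `169280cy1`: DIRECT Hesse certificate `(l : m) = (-4232 : 3)`, `u = 10580` -/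

/-- **`372416df1[3] ≃ 169280cy1[3]` as `Γ_ℚ`-modules, IN THE KERNEL** (no named fact): `372416df1` is `ℚ`-isomorphic to the
member `(l : m) = (-4232 : 3)`, `u = 10580`, of the Hesse pencil `X_E(3)` (Fisher 2012 Thm. 13.2; tree THEOREM) of `169280cy1`; the two covariant
identities are numeral identities (`norm_num`). [cite: Fisher2012Hessian, Thm. 13.2 (n = 3) and §8]
[cite: Cremona2006, Table 1 (Cremona labels 372416df1, 169280cy1)] -/
theorem torsionIso_e372416df1_e169280cy1 (W A : WeierstrassCurve ℚ) [W.IsElliptic] [A.IsElliptic]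
    (hW : W = ⟨0, -1, 0, -32445, 6208775⟩) (hA : A = ⟨0, -1, 0, -33089, 590657⟩) :
    TorsionIso A W 3 :=
  VisCerts.torsionIso3_of_hesseCert_mk
    hW hA
    (1557376 : ℚ) (-5355037376 : ℚ) (1588288 : ℚ) (-500797952 : ℚ)
    (by norm_num) (by norm_num) (by norm_num) (by norm_num)
    (-4232 : ℚ) (3 : ℚ) (10580 : ℚ) (by norm_num) (by norm_num) (by norm_num)

/-- **`S⁰(372416df1) = ⊥` IN THE KERNEL** (modulo the displayed PT fact, hMR, and the partner's census
`#Sel₃(169280cy1) = 3`): the partner's generator test `residualSelmerGroup_eq_bot_e169280cy1` transported along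
`torsionIso_e372416df1_e169280cy1` by `residualSelmerGroup_eq_bot_iff_of_congr` (both curves good at `3`, `decide`
on `Δ`). Per cell; EVIDENCE for TRIVIAL-ROADS §9; nothing booked, no count moved here.
[cite: MazurRubin2007, Prop. 1.3 (i) and Thm. 1.4] [cite: MazurRubin2015SelmerCompanions, Thm. 3.1 (iv)(b)]
[cite: Cremona2006, Table 1 (Cremona labels 372416df1, 169280cy1)] -/
theorem residualSelmerGroup_eq_bot_e372416df1 (hfact : poitouTate_selmerStructure_duality ℚ)
    (hMR : selmerLocalKer_iff_of_goodReduction_above)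
    (W A : WeierstrassCurve ℚ) [W.IsElliptic] [W.IsGloballyMinimal] [A.IsElliptic] [A.IsGloballyMinimal]
    (hIW : integralModelInt W = ⟨0, -1, 0, -33089, 590657⟩)
    (hIA : integralModelInt A = ⟨0, -1, 0, -32445, 6208775⟩)
    (hsA : Nat.card (A.selmerGroup (3 : ℤ)) = 3) : residualSelmerGroup W 3 = ⊥ := by
  have hW : W = ⟨0, -1, 0, -33089, 590657⟩ := by
    rw [IntModelTam.eq_baseChange_of_integralModelInt hIW]; ext <;> simp [baseChange, WeierstrassCurve.map]
  have hA : A = ⟨0, -1, 0, -32445, 6208775⟩ := by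
    rw [IntModelTam.eq_baseChange_of_integralModelInt hIA]; ext <;> simp [baseChange, WeierstrassCurve.map]
  obtain ⟨θ, hθ⟩ := torsionIso_e372416df1_e169280cy1 A W hA hW
  have hgood : ∀ v : HeightOneSpectrum (𝓞 ℚ), ((3 : ℕ) : 𝓞 ℚ) ∈ v.asIdeal →
      A.HasGoodReductionAt v ∧ W.HasGoodReductionAt v := fun v hv =>
    ⟨hasGoodReductionAt_of_map_eq_of_not_dvd (p := 3) A (hIA ▸ map_integralModelInt A)
        (by decide +kernel) v hv,
      hasGoodReductionAt_of_map_eq_of_not_dvd (p := 3) W (hIW ▸ map_integralModelInt W)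
        (by decide +kernel) v hv⟩
  exact (residualSelmerGroup_eq_bot_iff_of_congr A W 3 hMR (by decide) θ hθ hgood).mpr
    (residualSelmerGroup_eq_bot_e169280cy1 hfact A hIA hsA)

end Summit.BirchSwinnertonDyer.Rank1Residual.X10.ResidualSelmerGeneratorTestRecords

end
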